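import Mathlib.Analysis.Calculus.Deriv.Inv
import Mathlib.Analysis.Calculus.FDeriv.Mul
import Mathlib.Analysis.Calculus.FDeriv.Pi
import Mathlib.Analysis.Calculus.ContDiff.Operations
import Literature.NumberTheory.Transcendental.ProjectiveSpace
import HarnessLib

/-!
# The affine charts of projective space read upstairs: derivative and its kernel

Topic `Literature/Geometry/Kaehler` (chart calculus for maps into `ℙⁿ(ℂ)`, used by
`ProjectiveHyperplaneReal.lean` and the unfolding of the origami sphere in
`Literature/Geometry/Symplectic/OrigamiSphereBlowDown.lean`).

For the `i`-th standard affine chart `φᵢ` of `ℙᵐ(ℂ)` (`Projectivization.stdChart`,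
`Literature/NumberTheory/Transcendental/ProjectiveSpace.lean`) the composite with the projection
`ℂᵐ⁺¹ ∖ 0 → ℙᵐ` is the rational map `qchart i : w ↦ (w_{i.succAbove k} / wᵢ)_k`
(`stdChartFun_mk_eq_qchart`). This file records its complex derivative at a point with `wᵢ ≠ 0`
(`qchartDeriv`, `hasFDerivAt_qchart`, by the quotient rule in the form
`qchart i w = dropCoord i (wᵢ⁻¹ • w)`), its analyticity (`contDiffAt_qchart`), and the KERNEL of the
derivative: the complex line `ℂ w` through the point (`qchartDeriv_eq_zero_iff`) — the fibre
direction of `ℂᵐ⁺¹ ∖ 0 → ℙᵐ`, the one computation behind every rank statement about maps into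
projective space written in affine coordinates.

## References

* D. Huybrechts, *Complex Geometry* (2005), §2.1 pp. 56–57 (the affine atlas of `ℙⁿ`).
* P. Griffiths, J. Harris, *Principles of Algebraic Geometry* (1978), Ch. 0 §2 p. 15.
-/

noncomputable section

open Set Function Projectivization

namespace Literature.Geometry.Kaehler

/-! ### The affine chart map `qchart i` on `ℂᵐ⁺¹` and the kernel of its derivative -/

section QChart

variable {m : ℕ}

/-- The `i`-th affine chart of projective space read upstairs on `ℂᵐ⁺¹`:
`qchart i w = (w_{i.succAbove k} / wᵢ)_k`, so that `stdChartFun i [w] = qchart i w`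
(`Projectivization.stdChartFun_mk`). Huybrechts (2005), §2.1 p. 56.
[cite: HuybrechtsCG2005, §2.1 pp. 56–57] -/
def qchart (i : Fin (m + 1)) (w : Fin (m + 1) → ℂ) : Fin m → ℂ := fun k ↦ w (i.succAbove k) / w i

/-- `stdChartFun i [w] = qchart i w`. [folklore] -/
theorem stdChartFun_mk_eq_qchart (i : Fin (m + 1)) (w : Fin (m + 1) → ℂ) (hw : w ≠ 0) :
    stdChartFun i (Projectivization.mk ℂ w hw) = qchart i w :=
  stdChartFun_mk i w hw

/-- Dropping the `i`-th coordinate, `v ↦ (v_{i.succAbove k})_k`, as a continuous `ℂ`-linear map.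
[folklore] -/
def dropCoord (i : Fin (m + 1)) : (Fin (m + 1) → ℂ) →L[ℂ] (Fin m → ℂ) :=
  ContinuousLinearMap.pi fun k ↦ ContinuousLinearMap.proj (i.succAbove k)

/-- `dropCoord i v k = v (i.succAbove k)`. [folklore] -/
@[simp]
theorem dropCoord_apply (i : Fin (m + 1)) (v : Fin (m + 1) → ℂ) (k : Fin m) :
    dropCoord i v k = v (i.succAbove k) := rfl

/-- A vector with vanishing `i`-th coordinate is zero iff its other coordinates vanish. [folklore] -/
theorem dropCoord_eq_zero_iff (i : Fin (m + 1)) {v : Fin (m + 1) → ℂ} (hv : v i = 0) :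
    dropCoord i v = 0 ↔ v = 0 := by
  constructor
  · intro h
    funext l
    refine Fin.succAboveCases i hv (fun k ↦ ?_) l
    simpa using congrFun h k
  · rintro rfl
    simp

/-- `qchart i w = dropCoord i (wᵢ⁻¹ • w)`. [folklore] -/
theorem qchart_eq (i : Fin (m + 1)) (w : Fin (m + 1) → ℂ) :
    qchart i w = dropCoord i ((w i)⁻¹ • w) := by
  funext k
  simp [qchart, div_eq_inv_mul]

/-- The complex derivative of `qchart i` at `w` (meaningful for `wᵢ ≠ 0`):
`u ↦ dropCoord i (wᵢ⁻¹ u - (uᵢ / wᵢ²) w)` (quotient rule). [folklore] -/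
def qchartDeriv (i : Fin (m + 1)) (w : Fin (m + 1) → ℂ) : (Fin (m + 1) → ℂ) →L[ℂ] (Fin m → ℂ) :=
  (dropCoord i).comp ((w i)⁻¹ • ContinuousLinearMap.id ℂ (Fin (m + 1) → ℂ) +
    ((ContinuousLinearMap.toSpanSingleton ℂ (-(w i ^ 2)⁻¹)).comp
      (ContinuousLinearMap.proj i)).smulRight w)

/-- `qchartDeriv i w u = dropCoord i (wᵢ⁻¹ • u + (uᵢ · (-(wᵢ²)⁻¹)) • w)`. [folklore] -/
theorem qchartDeriv_apply (i : Fin (m + 1)) (w u : Fin (m + 1) → ℂ) :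
    qchartDeriv i w u = dropCoord i ((w i)⁻¹ • u + (u i * (-(w i ^ 2)⁻¹)) • w) := by
  simp [qchartDeriv, ContinuousLinearMap.toSpanSingleton_apply, smul_eq_mul]

/-- **Quotient rule for the affine chart**: at `w` with `wᵢ ≠ 0`, `qchart i` has complex
derivative `qchartDeriv i w`. [folklore] -/
theorem hasFDerivAt_qchart (i : Fin (m + 1)) {w : Fin (m + 1) → ℂ} (hw : w i ≠ 0) :
    HasFDerivAt (qchart i) (qchartDeriv i w) w := by
  have h1 : HasFDerivAt (fun w : Fin (m + 1) → ℂ ↦ (w i)⁻¹)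
      ((ContinuousLinearMap.toSpanSingleton ℂ (-(w i ^ 2)⁻¹)).comp
        (ContinuousLinearMap.proj i)) w :=
    (hasFDerivAt_inv hw).comp w (hasFDerivAt_apply i w)
  have h2 := h1.smul (hasFDerivAt_id (𝕜 := ℂ) w)
  have h3 := (dropCoord i).hasFDerivAt.comp w h2
  have hfun : qchart i = (dropCoord i) ∘ ((fun w : Fin (m + 1) → ℂ ↦ (w i)⁻¹) • id) := by
    funext w
    exact qchart_eq i w
  rw [hfun]
  exact h3

/-- `qchart i` is complex-analytic at every `w` with `wᵢ ≠ 0` (quotients of coordinates).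
[cite: HuybrechtsCG2005, §2.1 pp. 56–57] -/
theorem contDiffAt_qchart (i : Fin (m + 1)) {w : Fin (m + 1) → ℂ} (hw : w i ≠ 0) {k : WithTop ℕ∞} :
    ContDiffAt ℂ k (qchart i) w :=
  contDiffAt_pi.2 fun l ↦ (contDiff_apply ℂ ℂ (i.succAbove l)).contDiffAt.div
    (contDiff_apply ℂ ℂ i).contDiffAt hw

/-- **The kernel of the derivative of the affine chart is the complex line through the point**:
for `wᵢ ≠ 0`, `qchartDeriv i w u = 0 ↔ u ∈ ℂ w`. (The fibre direction of `ℂᵐ⁺¹ ∖ 0 → ℙᵐ` is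
exactly what the chart forgets.) [folklore] -/
theorem qchartDeriv_eq_zero_iff (i : Fin (m + 1)) {w : Fin (m + 1) → ℂ} (hw : w i ≠ 0)
    (u : Fin (m + 1) → ℂ) : qchartDeriv i w u = 0 ↔ ∃ c : ℂ, u = c • w := by
  rw [qchartDeriv_apply, dropCoord_eq_zero_iff]
  · constructor
    · intro h
      refine ⟨u i * (w i)⁻¹, ?_⟩
      have h' : (w i)⁻¹ • u = (u i * (w i ^ 2)⁻¹) • w := by
        rw [← sub_eq_zero, sub_eq_add_neg, ← neg_smul]
        simpa [neg_mul, mul_neg] using h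
      calc u = (w i) • ((w i)⁻¹ • u) := by rw [smul_smul, mul_inv_cancel₀ hw, one_smul]
        _ = (w i) • ((u i * (w i ^ 2)⁻¹) • w) := by rw [h']
        _ = (u i * (w i)⁻¹) • w := by
          rw [smul_smul]
          congr 1
          field_simp
    · rintro ⟨c, rfl⟩
      funext l
      simp only [Pi.add_apply, Pi.smul_apply, smul_eq_mul, Pi.zero_apply]
      field_simp
      ring
  · simp only [Pi.add_apply, Pi.smul_apply, smul_eq_mul]
    field_simp
    ring

end QChart

end Literature.Geometry.Kaehler
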